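import Summits.HodgeConjecture.HodgeConjecture.Theses.SecondaryPeriods
import Literature.AlgebraicGeometry.HodgeTheory.ConiveauDegreeDescent
import Literature.AlgebraicGeometry.HodgeTheory.ComplexOrientationDegreeFibre

/-!
# `LevelOneConiveauThreefolds` (route `SecondaryPeriods`, crux stmt-HodgeConjecture-10376):
# GHC(3,1) DESCENDS along morphisms of non-zero degree — reduction to dominating models

Line `registered` of the crux (`Cruxes/LevelOneConiveauThreefolds/Lines/birth.lean`), lead c2,
2026-08-17. The crux is Grothendieck's amended GHC(3,1) for smooth projective threefolds `Y/ℂ`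
(a rationally spanned sub-Hodge structure `W ⊆ H³(Y(ℂ); ℂ)` of Hodge coniveau `≥ 1` lies in
`N¹H³(Y) = supportedClasses Y 3 1`), an open problem whose two registered stubs are, in the tree,
(1) the route's own crux #6 `RiemannWeightOne` (stmt-HodgeConjecture-16406;
`levelOneSpanOfCurve_of_riemannWeightOne`) and (2) a statement kernel-certified EQUIVALENT to the
crux modulo (1) (`stub_converse_curveCorrespondenceAlgebraic`,
`stub_composition_levelOneConiveauThreefolds`). What a lead can still add are the structural
reductions every habitat line will use; this file records the basic one, absent from the tree so
far: **the body of the crux at `Y'` implies the body of the crux at `Y` whenever `Y' → Y` has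
non-zero degree** — finite base changes ("after a finite base change, …"), generically finite
covers with a degree, birational models (blow-ups, resolved modifications).

* `span_le_supportedClasses_of_hasDegree` — pointwise descent along `g : Y' ⟶ Y` with
  `HasDegree μ ν g(ℂ) d`, `d ≠ 0`: the crux's data `(A, s)` at `Y` pull back to data
  `(B'.induce A, g^* s)` at `Y'` which are again rational (`IsRationalClass.map`), sub-Hodge and of
  Hodge coniveau `≥ 1` — in the INDUCED Hodge model of `Y'`, so that no rigidity of de Rham
  comparisons is needed (`HodgeModel.map_map_pullback_eq_iSup_inf_hodgePQ_induce`,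
  `HodgeModel.map_map_pullback_le_iSup_hodgePQ_induce`; Voisin I §7.3.2) —, hence
  `g^* W ⊆ N¹H³(Y')` by the hypothesis at `Y'`, and coniveau descends:
  `d • w = g_!(g^* w) ∈ g_!(N¹H³(Y')) ⊆ N¹H³(Y)` (`mem_supportedClasses_of_map_mem_of_hasDegree`:
  projection formula + support property of Gysin maps, both theorems of the tree);
* `span_le_supportedClasses_of_isBirational` — the birational case (degree one,
  `exists_hasDegree_one_of_isBirational`): GHC(3,1) for any smooth projective birational model
  mapping to `Y` gives it for `Y`;
* `levelOneConiveauThreefolds_of_dominating` — the crux BY NAME from GHC(3,1) on any class `𝒞` of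
  threefolds dominating every threefold with non-zero degree (reduction principle);
* `exists_not_le_supportedClasses_of_hasDegree` — negative side: a witness of `ConiveauOneFailure`
  at `Y` (the route's intended attractor witness) yields one on every `Y'` of non-zero degree over
  `Y`; the habitat of the negative crux is closed under finite base change and birational
  modification, so a witness may be certified on any convenient model.
-/

noncomputable section

-- `Summit.HodgeConjecture.HodgeConjecture.Theorems` is the mandated namespace (single-conjunct summit:
-- Sub = Summit), which `linter.dupNamespace` flags on every declaration; the lakefile turns the
-- linter off tree-wide (weak option), restated here so stand-alone elaboration is warning-free too.
set_option linter.dupNamespace false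
namespace Summit.HodgeConjecture.HodgeConjecture.Theorems

open CategoryTheory AlgebraicGeometry
open Literature.AlgebraicTopology.SingularHomology
open Literature.AlgebraicGeometry Literature.AlgebraicGeometry.Motives
open Literature.AlgebraicGeometry.HodgeTheory

/-- **GHC(3,1) descends along morphisms of non-zero degree (pointwise form of the crux).** Let
`g : Y' ⟶ Y` be a `ℂ`-morphism of smooth projective threefolds of degree `d ≠ 0`
(`g(ℂ)_*[Y'(ℂ)] = d • [Y(ℂ)]` for orientations `μ`, `ν`; e.g. a finite base change, a generically
finite cover with a degree, a birational model). If every rationally spanned sub-Hodge structure of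
`H³(Y'(ℂ); ℂ)` of Hodge coniveau `≥ 1` (read in ANY Hodge model of `Y'`) lies in `N¹H³(Y')` — the
body of `LevelOneConiveauThreefolds` at `Y'` — then the same holds at `Y`: for the crux's data
`(A, s)` at `Y`, the pulled-back data `(B'.induce A, g^* s)` at `Y'` is again rational
(`IsRationalClass.map`), sub-Hodge and of Hodge coniveau `≥ 1` in the INDUCED Hodge model
(`HodgeModel.map_map_pullback_eq_iSup_inf_hodgePQ_induce`,
`HodgeModel.map_map_pullback_le_iSup_hodgePQ_induce`: `g^*` is a morphism of Hodge structures,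
Voisin I §7.3.2, no rigidity of de Rham comparisons needed), so `g^* W ⊆ N¹H³(Y')`, and coniveau
descends: `g_!(g^* w) = d • w ∈ g_!(N¹H³(Y')) ⊆ N¹H³(Y)`
(`mem_supportedClasses_of_map_mem_of_hasDegree`). [cite: GrothendieckTopology1969, §1 and p. 301]
[cite: VoisinHodgeI2002, §7.3.2] [cite: FultonYoungTableaux1997, Appendix B §B.1 (5)–(7)]
[cite: VoisinHodgeII2003, §9.2.4 Prop. 9.21 (ii)] -/
theorem span_le_supportedClasses_of_hasDegree {Y' Y : SchemeOver ℂ}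
    (hY' : IsSmoothProjective 3 Y') (hY : IsSmoothProjective 3 Y) (g : Y' ⟶ Y)
    (μ : HomologicalOrientation ℂ (ComplexPoints Y') (2 * 3))
    (ν : HomologicalOrientation ℂ (ComplexPoints Y) (2 * 3)) {d : ℤ} (hd : d ≠ 0)
    (hg : HasDegree μ ν (AlgPoints.mapContinuous (L := ℂ) g) d)
    (h' : ∀ (A' : HodgeModel 3 Y') (s' : Finset (complexBetti Y' 3)), (∀ c ∈ s', IsRationalClass c) →
      (Submodule.span ℂ (↑s' : Set (complexBetti Y' 3))).map (A'.pullback 3).hom =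
        (⨆ (p : ℕ) (q : ℕ) (_ : p + q = 3),
          (Submodule.span ℂ (↑s' : Set (complexBetti Y' 3))).map (A'.pullback 3).hom ⊓
            A'.hodgePQ 3 p q) →
      (Submodule.span ℂ (↑s' : Set (complexBetti Y' 3))).map (A'.pullback 3).hom ≤
        (⨆ (p : ℕ) (q : ℕ) (_ : p + q = 3) (_ : 1 ≤ p) (_ : 1 ≤ q), A'.hodgePQ 3 p q) →
      Submodule.span ℂ (↑s' : Set (complexBetti Y' 3)) ≤ supportedClasses Y' 3 1)
    (A : HodgeModel 3 Y) (s : Finset (complexBetti Y 3)) (hs : ∀ c ∈ s, IsRationalClass c)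
    (hsub : (Submodule.span ℂ (↑s : Set (complexBetti Y 3))).map (A.pullback 3).hom =
      ⨆ (p : ℕ) (q : ℕ) (_ : p + q = 3),
        (Submodule.span ℂ (↑s : Set (complexBetti Y 3))).map (A.pullback 3).hom ⊓ A.hodgePQ 3 p q)
    (hlev : (Submodule.span ℂ (↑s : Set (complexBetti Y 3))).map (A.pullback 3).hom ≤
      ⨆ (p : ℕ) (q : ℕ) (_ : p + q = 3) (_ : 1 ≤ p) (_ : 1 ≤ q), A.hodgePQ 3 p q) :
    Submodule.span ℂ (↑s : Set (complexBetti Y 3)) ≤ supportedClasses Y 3 1 := by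
  classical
  obtain ⟨B'⟩ := (nonempty_hodgeModel_holds (n := 3) (X := Y')).nonempty hY'
  -- the pulled-back data `(B'.induce A, g^* s)` at `Y'`
  have hW' : Submodule.span ℂ (↑(s.image (complexBetti.map g 3).hom) : Set (complexBetti Y' 3)) =
      (Submodule.span ℂ (↑s : Set (complexBetti Y 3))).map (complexBetti.map g 3).hom := by
    rw [Finset.coe_image, Submodule.span_image]
  have hs' : ∀ c ∈ s.image (complexBetti.map g 3).hom, IsRationalClass c := by
    intro c hc
    obtain ⟨c₀, hc₀, rfl⟩ := Finset.mem_image.1 hc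
    exact (hs c₀ hc₀).map _
  have hle : (Submodule.span ℂ (↑s : Set (complexBetti Y 3))).map (complexBetti.map g 3).hom ≤
      supportedClasses Y' 3 1 := by
    rw [← hW']
    refine h' (B'.induce A le_rfl) _ hs' ?_ ?_
    · rw [hW']
      exact HodgeModel.map_map_pullback_eq_iSup_inf_hodgePQ_induce hY' hY B' A le_rfl g hsub
    · rw [hW']
      exact HodgeModel.map_map_pullback_le_iSup_hodgePQ_induce hY' hY B' A le_rfl g hlev
  intro w hw
  exact mem_supportedClasses_of_map_mem_of_hasDegree hY' hY g μ ν hd hg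
    (hle (Submodule.mem_map_of_mem hw))

/-- **GHC(3,1) descends along birational morphisms** (from a blow-up, or any smooth projective
birational model mapping to `Y`, to `Y`): a birational `σ : Y' ⟶ Y` has degree one for suitable
orientations (`exists_hasDegree_one_of_isBirational`). [cite: GrothendieckTopology1969, §1 and p. 301]
[cite: Fulton1998, Lemma 19.1.2] -/
theorem span_le_supportedClasses_of_isBirational {Y' Y : SchemeOver ℂ}
    (hY' : IsSmoothProjective 3 Y') (hY : IsSmoothProjective 3 Y) (σ : Y' ⟶ Y)
    (hσ : Resolution.IsBirational σ.left)
    (h' : ∀ (A' : HodgeModel 3 Y') (s' : Finset (complexBetti Y' 3)), (∀ c ∈ s', IsRationalClass c) →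
      (Submodule.span ℂ (↑s' : Set (complexBetti Y' 3))).map (A'.pullback 3).hom =
        (⨆ (p : ℕ) (q : ℕ) (_ : p + q = 3),
          (Submodule.span ℂ (↑s' : Set (complexBetti Y' 3))).map (A'.pullback 3).hom ⊓
            A'.hodgePQ 3 p q) →
      (Submodule.span ℂ (↑s' : Set (complexBetti Y' 3))).map (A'.pullback 3).hom ≤
        (⨆ (p : ℕ) (q : ℕ) (_ : p + q = 3) (_ : 1 ≤ p) (_ : 1 ≤ q), A'.hodgePQ 3 p q) →
      Submodule.span ℂ (↑s' : Set (complexBetti Y' 3)) ≤ supportedClasses Y' 3 1)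
    (A : HodgeModel 3 Y) (s : Finset (complexBetti Y 3)) (hs : ∀ c ∈ s, IsRationalClass c)
    (hsub : (Submodule.span ℂ (↑s : Set (complexBetti Y 3))).map (A.pullback 3).hom =
      ⨆ (p : ℕ) (q : ℕ) (_ : p + q = 3),
        (Submodule.span ℂ (↑s : Set (complexBetti Y 3))).map (A.pullback 3).hom ⊓ A.hodgePQ 3 p q)
    (hlev : (Submodule.span ℂ (↑s : Set (complexBetti Y 3))).map (A.pullback 3).hom ≤
      ⨆ (p : ℕ) (q : ℕ) (_ : p + q = 3) (_ : 1 ≤ p) (_ : 1 ≤ q), A.hodgePQ 3 p q) :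
    Submodule.span ℂ (↑s : Set (complexBetti Y 3)) ≤ supportedClasses Y 3 1 := by
  obtain ⟨μ, ν, h1⟩ := exists_hasDegree_one_of_isBirational hY' hY σ hσ
  exact span_le_supportedClasses_of_hasDegree hY' hY σ μ ν one_ne_zero h1 h' A s hs hsub hlev

/-- **Reduction principle for the crux: it suffices to prove GHC(3,1) on a DOMINATING class of
threefolds.** If `𝒞` is any class of smooth projective threefolds such that every smooth projective
threefold `Y` receives a morphism of non-zero degree from a member of `𝒞` (finite base changes,
resolved finite covers, birational models …), then GHC(3,1) on `𝒞` gives the crux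
`LevelOneConiveauThreefolds` by name. [cite: GrothendieckTopology1969, §1 and p. 301]
[cite: FultonYoungTableaux1997, Appendix B §B.1 (5)–(7)] -/
theorem levelOneConiveauThreefolds_of_dominating (𝒞 : SchemeOver ℂ → Prop)
    (hdom : ∀ ⦃Y : SchemeOver ℂ⦄, IsSmoothProjective 3 Y →
      ∃ (Y' : SchemeOver ℂ) (_ : 𝒞 Y') (_ : IsSmoothProjective 3 Y') (g : Y' ⟶ Y)
        (μ : HomologicalOrientation ℂ (ComplexPoints Y') (2 * 3))
        (ν : HomologicalOrientation ℂ (ComplexPoints Y) (2 * 3)) (d : ℤ),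
        d ≠ 0 ∧ HasDegree μ ν (AlgPoints.mapContinuous (L := ℂ) g) d)
    (h𝒞 : ∀ ⦃Y' : SchemeOver ℂ⦄, 𝒞 Y' → IsSmoothProjective 3 Y' →
      ∀ (A' : HodgeModel 3 Y') (s' : Finset (complexBetti Y' 3)), (∀ c ∈ s', IsRationalClass c) →
      (Submodule.span ℂ (↑s' : Set (complexBetti Y' 3))).map (A'.pullback 3).hom =
        (⨆ (p : ℕ) (q : ℕ) (_ : p + q = 3),
          (Submodule.span ℂ (↑s' : Set (complexBetti Y' 3))).map (A'.pullback 3).hom ⊓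
            A'.hodgePQ 3 p q) →
      (Submodule.span ℂ (↑s' : Set (complexBetti Y' 3))).map (A'.pullback 3).hom ≤
        (⨆ (p : ℕ) (q : ℕ) (_ : p + q = 3) (_ : 1 ≤ p) (_ : 1 ≤ q), A'.hodgePQ 3 p q) →
      Submodule.span ℂ (↑s' : Set (complexBetti Y' 3)) ≤ supportedClasses Y' 3 1) :
    Theses.SecondaryPeriods.LevelOneConiveauThreefolds := by
  intro Y hY A s hs hsub hlev
  obtain ⟨Y', hY'𝒞, hY', g, μ, ν, d, hd, hg⟩ := hdom hY
  exact span_le_supportedClasses_of_hasDegree hY' hY g μ ν hd hg (h𝒞 hY'𝒞 hY') A s hs hsub hlev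

/-- **Negative side: a witness of `ConiveauOneFailure` lifts along morphisms of non-zero degree.**
If the crux's conclusion FAILS at `Y` for some data `(A, s)` (a rational level-one sub-Hodge
structure of `H³(Y)` not supported on a divisor — the route's intended attractor witness), then it
fails at every smooth projective threefold `Y'` mapping to `Y` with non-zero degree (every finite
base change with a degree, every blow-up / birational model of `Y`): the habitat of the negative
crux is closed under such covers, so a witness may be certified on any convenient model.
[cite: GrothendieckTopology1969, §1 and p. 301] [cite: FultonYoungTableaux1997, Appendix B §B.1 (5)–(7)] -/
theorem exists_not_le_supportedClasses_of_hasDegree {Y' Y : SchemeOver ℂ}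
    (hY' : IsSmoothProjective 3 Y') (hY : IsSmoothProjective 3 Y) (g : Y' ⟶ Y)
    (μ : HomologicalOrientation ℂ (ComplexPoints Y') (2 * 3))
    (ν : HomologicalOrientation ℂ (ComplexPoints Y) (2 * 3)) {d : ℤ} (hd : d ≠ 0)
    (hg : HasDegree μ ν (AlgPoints.mapContinuous (L := ℂ) g) d)
    (A : HodgeModel 3 Y) (s : Finset (complexBetti Y 3)) (hs : ∀ c ∈ s, IsRationalClass c)
    (hsub : (Submodule.span ℂ (↑s : Set (complexBetti Y 3))).map (A.pullback 3).hom =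
      ⨆ (p : ℕ) (q : ℕ) (_ : p + q = 3),
        (Submodule.span ℂ (↑s : Set (complexBetti Y 3))).map (A.pullback 3).hom ⊓ A.hodgePQ 3 p q)
    (hlev : (Submodule.span ℂ (↑s : Set (complexBetti Y 3))).map (A.pullback 3).hom ≤
      ⨆ (p : ℕ) (q : ℕ) (_ : p + q = 3) (_ : 1 ≤ p) (_ : 1 ≤ q), A.hodgePQ 3 p q)
    (hfail : ¬ Submodule.span ℂ (↑s : Set (complexBetti Y 3)) ≤ supportedClasses Y 3 1) :
    ∃ (A' : HodgeModel 3 Y') (s' : Finset (complexBetti Y' 3)), (∀ c ∈ s', IsRationalClass c) ∧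
      (Submodule.span ℂ (↑s' : Set (complexBetti Y' 3))).map (A'.pullback 3).hom =
        (⨆ (p : ℕ) (q : ℕ) (_ : p + q = 3),
          (Submodule.span ℂ (↑s' : Set (complexBetti Y' 3))).map (A'.pullback 3).hom ⊓
            A'.hodgePQ 3 p q) ∧
      (Submodule.span ℂ (↑s' : Set (complexBetti Y' 3))).map (A'.pullback 3).hom ≤
        (⨆ (p : ℕ) (q : ℕ) (_ : p + q = 3) (_ : 1 ≤ p) (_ : 1 ≤ q), A'.hodgePQ 3 p q) ∧
      ¬ Submodule.span ℂ (↑s' : Set (complexBetti Y' 3)) ≤ supportedClasses Y' 3 1 := by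
  by_contra hcon
  refine hfail (span_le_supportedClasses_of_hasDegree hY' hY g μ ν hd hg ?_ A s hs hsub hlev)
  intro A' s' hs' hsub' hlev'
  by_contra hfail'
  exact hcon ⟨A', s', hs', hsub', hlev', hfail'⟩

/-! ### Registered sub-goal of the line (pure-signature form, keyed by the registered stub name) -/

/-- **Registered sub-goal `stub_descent_of_hasDegree`** of line `registered` of crux
stmt-HodgeConjecture-10376 (lead c2): the descent of GHC(3,1) along morphisms of non-zero degree,
in pure-signature form — `span_le_supportedClasses_of_hasDegree` re-keyed by the registered name.
[cite: GrothendieckTopology1969, §1 and p. 301] [cite: FultonYoungTableaux1997, Appendix B §B.1 (5)–(7)] -/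
theorem stub_descent_of_hasDegree : ∀ ⦃Y' Y : Motives.SchemeOver ℂ⦄ (hY' : Motives.IsSmoothProjective 3 Y') (hY : Motives.IsSmoothProjective 3 Y) (g : Y' ⟶ Y) (μ : HomologicalOrientation ℂ (Motives.ComplexPoints Y') (2 * 3)) (ν : HomologicalOrientation ℂ (Motives.ComplexPoints Y) (2 * 3)) (d : ℤ), d ≠ 0 → HasDegree μ ν (Motives.AlgPoints.mapContinuous (L := ℂ) g) d → (∀ (A' : HodgeModel 3 Y') (s' : Finset (complexBetti Y' 3)), (∀ c ∈ s', IsRationalClass c) → (Submodule.span ℂ (↑s' : Set (complexBetti Y' 3))).map (A'.pullback 3).hom = (⨆ (p : ℕ) (q : ℕ) (_ : p + q = 3), (Submodule.span ℂ (↑s' : Set (complexBetti Y' 3))).map (A'.pullback 3).hom ⊓ A'.hodgePQ 3 p q) → (Submodule.span ℂ (↑s' : Set (complexBetti Y' 3))).map (A'.pullback 3).hom ≤ (⨆ (p : ℕ) (q : ℕ) (_ : p + q = 3) (_ : 1 ≤ p) (_ : 1 ≤ q), A'.hodgePQ 3 p q) → Submodule.span ℂ (↑s' : Set (complexBetti Y'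 3)) ≤ supportedClasses Y' 3 1) → ∀ (A : HodgeModel 3 Y) (s : Finset (complexBetti Y 3)), (∀ c ∈ s, IsRationalClass c) → (Submodule.span ℂ (↑s : Set (complexBetti Y 3))).map (A.pullback 3).hom = (⨆ (p : ℕ) (q : ℕ) (_ : p + q = 3), (Submodule.span ℂ (↑s : Set (complexBetti Y 3))).map (A.pullback 3).hom ⊓ A.hodgePQ 3 p q) → (Submodule.span ℂ (↑s : Set (complexBetti Y 3))).map (A.pullback 3).hom ≤ (⨆ (p : ℕ) (q : ℕ) (_ : p + q = 3) (_ : 1 ≤ p) (_ : 1 ≤ q), A.hodgePQ 3 p q) → Submodule.span ℂ (↑s : Set (complexBetti Y 3)) ≤ supportedClasses Y 3 1 :=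
  fun _ _ hY' hY g μ ν _ hd hg h' A s hs hsub hlev ↦
    span_le_supportedClasses_of_hasDegree hY' hY g μ ν hd hg h' A s hs hsub hlev

/-! ### Appended (v2): descent along a morphism with a finite étale fibre — the geometric form of
"non-zero degree" (generically finite covers, finite base changes) -/

/-- **GHC(3,1) descends along a morphism with one finite fibre of local-homeomorphism points.**
Let `q : Y' ⟶ Y` be a morphism of smooth projective threefolds and `b` a complex point of `Y` whose
fibre `q(ℂ)⁻¹(b) = {v i}ᵢ` is finite and NON-EMPTY, with `q(ℂ)` a local homeomorphism at every
`v i` (e.g. `b` in the finite étale locus of a generically finite dominant `q`: a finite base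
change, a resolved finite cover). Then `q(ℂ)_*[Y'(ℂ)] = (#ι) • [Y(ℂ)]` for the complex orientations
(`hasDegree_toCoeff_complexOrientationInt_of_finite_fibre`, Fulton Lemma 19.1.2 read topologically),
`#ι ≠ 0`, and the body of the crux descends from `Y'` to `Y`
(`span_le_supportedClasses_of_hasDegree`). [cite: Fulton1998, Lemma 19.1.2]
[cite: GrothendieckTopology1969, §1 and p. 301] -/
theorem span_le_supportedClasses_of_finite_fibre {Y' Y : SchemeOver ℂ}
    (hY' : IsSmoothProjective 3 Y') (hY : IsSmoothProjective 3 Y) (q : Y' ⟶ Y)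
    {ι : Type} [Fintype ι] [Nonempty ι] {v : ι → ComplexPoints Y'} (hv : Function.Injective v)
    {b : ComplexPoints Y} (hfibre : (AlgPoints.map q) ⁻¹' {b} = Set.range v)
    (hloc : ∀ i, ∃ e : OpenPartialHomeomorph (ComplexPoints Y') (ComplexPoints Y),
      v i ∈ e.source ∧ (e : ComplexPoints Y' → ComplexPoints Y) = AlgPoints.map q)
    (h' : ∀ (A' : HodgeModel 3 Y') (s' : Finset (complexBetti Y' 3)), (∀ c ∈ s', IsRationalClass c) →
      (Submodule.span ℂ (↑s' : Set (complexBetti Y' 3))).map (A'.pullback 3).hom =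
        (⨆ (p : ℕ) (q : ℕ) (_ : p + q = 3),
          (Submodule.span ℂ (↑s' : Set (complexBetti Y' 3))).map (A'.pullback 3).hom ⊓
            A'.hodgePQ 3 p q) →
      (Submodule.span ℂ (↑s' : Set (complexBetti Y' 3))).map (A'.pullback 3).hom ≤
        (⨆ (p : ℕ) (q : ℕ) (_ : p + q = 3) (_ : 1 ≤ p) (_ : 1 ≤ q), A'.hodgePQ 3 p q) →
      Submodule.span ℂ (↑s' : Set (complexBetti Y' 3)) ≤ supportedClasses Y' 3 1)
    (A : HodgeModel 3 Y) (s : Finset (complexBetti Y 3)) (hs : ∀ c ∈ s, IsRationalClass c)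
    (hsub : (Submodule.span ℂ (↑s : Set (complexBetti Y 3))).map (A.pullback 3).hom =
      ⨆ (p : ℕ) (q : ℕ) (_ : p + q = 3),
        (Submodule.span ℂ (↑s : Set (complexBetti Y 3))).map (A.pullback 3).hom ⊓ A.hodgePQ 3 p q)
    (hlev : (Submodule.span ℂ (↑s : Set (complexBetti Y 3))).map (A.pullback 3).hom ≤
      ⨆ (p : ℕ) (q : ℕ) (_ : p + q = 3) (_ : 1 ≤ p) (_ : 1 ≤ q), A.hodgePQ 3 p q) :
    Submodule.span ℂ (↑s : Set (complexBetti Y 3)) ≤ supportedClasses Y 3 1 := by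
  letI := hY'.chartedSpace
  letI := hY.chartedSpace
  haveI := ComplexPoints.t2Space_of_isSmoothProjective hY'
  haveI := ComplexPoints.t2Space_of_isSmoothProjective hY
  have hdeg := hasDegree_toCoeff_complexOrientationInt_of_finite_fibre ℂ hY' hY q hv hfibre hloc
  exact span_le_supportedClasses_of_hasDegree hY' hY q _ _
    (Int.natCast_ne_zero.2 Fintype.card_ne_zero) hdeg h' A s hs hsub hlev

/-- **Registered sub-goal `stub_descent_of_finiteFibre`** of line `registered` of crux
stmt-HodgeConjecture-10376 (lead c2): the finite-fibre (geometric) form of the descent, in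
pure-signature form — `span_le_supportedClasses_of_finite_fibre` re-keyed by the registered name.
[cite: Fulton1998, Lemma 19.1.2] [cite: GrothendieckTopology1969, §1 and p. 301] -/
theorem stub_descent_of_finiteFibre : ∀ ⦃Y' Y : Motives.SchemeOver ℂ⦄ (hY' : Motives.IsSmoothProjective 3 Y') (hY : Motives.IsSmoothProjective 3 Y) (q : Y' ⟶ Y) (ι : Type) [Fintype ι] [Nonempty ι] (v : ι → Motives.ComplexPoints Y'), Function.Injective v → ∀ (b : Motives.ComplexPoints Y), Motives.AlgPoints.map q ⁻¹' {b} = Set.range v → (∀ i, ∃ e : OpenPartialHomeomorph (Motives.ComplexPoints Y') (Motives.ComplexPoints Y), v i ∈ e.source ∧ (e : Motives.ComplexPoints Y' → Motives.ComplexPoints Y) = Motives.AlgPoints.map q) → (∀ (A' : HodgeModel 3 Y') (s' : Finset (complexBetti Y' 3)), (∀ c ∈ s', IsRationalClass c) → (Submodule.span ℂ (↑s' : Set (complexBetti Y' 3))).map (A'.pullback 3).hom = (⨆ (p : ℕ) (q : ℕ) (_ : p + q = 3), (Submodule.span ℂ (↑s' : Set (complexBetti Y' 3))).map (A'.pullback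 3).hom ⊓ A'.hodgePQ 3 p q) → (Submodule.span ℂ (↑s' : Set (complexBetti Y' 3))).map (A'.pullback 3).hom ≤ (⨆ (p : ℕ) (q : ℕ) (_ : p + q = 3) (_ : 1 ≤ p) (_ : 1 ≤ q), A'.hodgePQ 3 p q) → Submodule.span ℂ (↑s' : Set (complexBetti Y' 3)) ≤ supportedClasses Y' 3 1) → ∀ (A : HodgeModel 3 Y) (s : Finset (complexBetti Y 3)), (∀ c ∈ s, IsRationalClass c) → (Submodule.span ℂ (↑s : Set (complexBetti Y 3))).map (A.pullback 3).hom = (⨆ (p : ℕ) (q : ℕ) (_ : p + q = 3), (Submodule.span ℂ (↑s : Set (complexBetti Y 3))).map (A.pullback 3).hom ⊓ A.hodgePQ 3 p q) → (Submodule.span ℂ (↑s : Set (complexBetti Y 3))).map (A.pullback 3).hom ≤ (⨆ (p : ℕ) (q : ℕ) (_ : p + q = 3) (_ : 1 ≤ p) (_ : 1 ≤ q), A.hodgePQ 3 p q) → Submodule.span ℂ (↑s : Set (complexBetti Y 3)) ≤ supportedClasses Y 3 1 :=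
  fun _ _ hY' hY q _ _ _ _ hv _ hfibre hloc h' A s hs hsub hlev ↦
    span_le_supportedClasses_of_finite_fibre hY' hY q hv hfibre hloc h' A s hs hsub hlev

end Summit.HodgeConjecture.HodgeConjecture.Theorems

end
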